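import Summits.Langlands.Langlands.Theses.DedekindQuotient1951
import Summits.Langlands.Langlands.Theorems.QuinticDedekindPole.Negative.QuinticDedekindPoleFalseOfCertificateHypothesis

/-!
# `QuinticDedekindPole` (stmt-Langlands-17270) — the negative lemma modulo `CertificateHypothesis`, concluded BY NAME

One-line corollary of `QuinticDedekindPole_false_of_CertificateHypothesis` (landed in
`…/Negative/QuinticDedekindPoleFalseOfCertificateHypothesis.lean` with the route decl written out, delta-equal, because the farm did
not serve `Summits.Langlands.Langlands.Theses.DedekindQuotient1951` coherently at filing time): here the conclusion is literally
`¬ Summit.Langlands.Langlands.Theses.DedekindQuotient1951.QuinticDedekindPole`.  Kernel-checked, no `sorry`; nothing about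
`Langlands` is proved or refuted (the negative route loses its computational bet; closure class `computation`, operator decision).
-/

-- `Summit.<Summit>.<Problem>`: for the single-conjunct summit `Langlands` the duplicate is mandated.
set_option linter.dupNamespace false

namespace Summit.Langlands.Langlands.Theorems.QuinticDedekindPole.Negative

/-- **`QuinticDedekindPole` is false modulo the certificate hypothesis** (route decl by name): if at every zero of `ζ` in the box
`0 < re s, |im s| < 100` the continued Dedekind zeta functions of the `C₅`- and `D₅`-fixed fields of every Doud–Moore `A₅` datum have
equal order (`CertificateHypothesis` — certified numerically by census instrument I-DQ, kit j342262), then the crux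
`QuinticDedekindPole` of route `DedekindQuotient1951` fails. [cite: Booker2006, §2 Prop. 3] -/
theorem QuinticDedekindPole_false_of_CertificateHypothesis_named (hcert : CertificateHypothesis) :
    ¬ Summit.Langlands.Langlands.Theses.DedekindQuotient1951.QuinticDedekindPole :=
  QuinticDedekindPole_false_of_CertificateHypothesis hcert

end Summit.Langlands.Langlands.Theorems.QuinticDedekindPole.Negative
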